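import Summits.ValiantsHypothesis.ValiantsHypothesis.Theorems.GrenetZeonDualUnipotentThreeHalvesHeavyTopHalfSpeedAllocation

/-!
# `GrenetZeon.DualUnipotentThreeHalves` (stmt-ValiantsHypothesis-24318), LINE β `half_speed`, K1 (ii-ARITH) COMPOSITE (desk g14 #332):
# THE PACKING INEQUALITIES in the loop writer's currency (val-port-3 g2's `exists_halfSpeed_chain`: height `Σ_{t<L} h t + (L − 1)`,
# codimension `Σ_{t<L} dim U_t − Σ_{t<L} dim T_t`)

(ii-ARITH) hand val-port-2 g2, over the atoms ✓ p663930 `…HalfSpeedAllocation`.  Pure ℕ; per level `t < L` of the (coarsened) chain: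
size `g t` (`Σ g = D > 0`), height `h t`, block-space dimension `u t = dim U_t`, kept dimension `v t = dim T_t`.  CERTIFIED levels:
`4D ≤ Θ·g t`, `h t = Θ·g t/(4D)` and C⁺'s `h t·(u t − v t) ≤ C·(g t)²`; KILLED levels: `h t = 0`, `u t ≤ (g t)²`, `Θ·g t < 8D`; and the
coarsening guarantee «few killed levels»: `#kill ≤ Θ/4 + #cert + 1` (full kill groups have size `≥ 4D/Θ`, at most one leftover per run).
★ `packing_height` : `Σ_{t<L} h t + (L − 1) ≤ Θ`.  ★ `packing_codim` : `Θ·(Σ u − Σ v) ≤ 8(C+1)·D²`.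

Honest framing.  Arithmetic (`--supports stmt-ValiantsHypothesis-24318 --as helper`); proves nothing about K1, `HalfSpeedIrrLaw`, R2, the crux,
8062 or `VP ≠ VNP` — all OPEN / NOT proved. [desk #332; port-3 loop statement of record 20:04:57Z]
-/

set_option linter.dupNamespace false
set_option autoImplicit false

namespace Summit.ValiantsHypothesis.ValiantsHypothesis.Theorems.GrenetZeon.HalfSpeed

open scoped BigOperators

/-- ★ **PACKING — HEIGHT.**  Certified heights sum to `≤ Θ/4` (A1), certified levels are `≤ Θ/4` in number (A2), killed levels are
`≤ Θ/4 + #cert + 1` in number (coarsening guarantee), killed heights are `0`; hence `Σ h + (L − 1) ≤ Θ`. [this file] -/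
theorem packing_height (L Θ D : ℕ) (g h : ℕ → ℕ) (cert : ℕ → Prop) [DecidablePred cert]
    (hD : ∑ t ∈ Finset.range L, g t = D) (hDpos : 0 < D)
    (hcert : ∀ t ∈ Finset.range L, cert t → 4 * D ≤ Θ * g t ∧ h t = Θ * g t / (4 * D))
    (hkill : ∀ t ∈ Finset.range L, ¬ cert t → h t = 0)
    (hfew : ((Finset.range L).filter fun t => ¬ cert t).card ≤ Θ / 4 + ((Finset.range L).filter cert).card + 1) :
    ∑ t ∈ Finset.range L, h t + (L - 1) ≤ Θ := by
  classical
  set Sc := (Finset.range L).filter cert with hSc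
  set Sk := (Finset.range L).filter fun t => ¬ cert t with hSk
  -- heights: only certified levels count, and they sum to ≤ Θ/4
  have hsplit : ∑ t ∈ Finset.range L, h t = ∑ t ∈ Sc, h t + ∑ t ∈ Sk, h t :=
    (Finset.sum_filter_add_sum_filter_not (Finset.range L) cert h).symm
  have hk0 : ∑ t ∈ Sk, h t = 0 :=
    Finset.sum_eq_zero fun t ht => by
      rw [hSk, Finset.mem_filter] at ht
      exact hkill t ht.1 ht.2
  have hc : ∑ t ∈ Sc, h t = ∑ t ∈ Sc, Θ * g t / (4 * D) :=
    Finset.sum_congr rfl fun t ht => by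
      rw [hSc, Finset.mem_filter] at ht
      exact (hcert t ht.1 ht.2).2
  have hA1 : ∑ t ∈ Sc, Θ * g t / (4 * D) ≤ Θ / 4 :=
    sum_heights_le Sc (Finset.range L) (Finset.filter_subset _ _) g D Θ 4 hD hDpos
  -- number of certified levels ≤ Θ/4
  have hA2 : 4 * D * Sc.card ≤ Θ * D :=
    card_fat_le Sc (Finset.range L) (Finset.filter_subset _ _) g D Θ hD fun t ht => by
      rw [hSc, Finset.mem_filter] at ht
      exact (hcert t ht.1 ht.2).1
  have hcard_c : Sc.card ≤ Θ / 4 := by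
    rw [Nat.le_div_iff_mul_le (by norm_num : 0 < 4)]
    have : Sc.card * 4 * D ≤ Θ * D := by
      calc Sc.card * 4 * D = 4 * D * Sc.card := by ring
        _ ≤ Θ * D := hA2
    exact Nat.le_of_mul_le_mul_right this hDpos
  -- number of levels
  have hL : L = Sc.card + Sk.card := by
    rw [hSc, hSk, Finset.card_filter_add_card_filter_not, Finset.card_range]
  have h4 : 4 * (Θ / 4) ≤ Θ := Nat.mul_div_le Θ 4
  rw [hsplit, hk0, hc, hL]
  omega

/-- ★ **PACKING — CODIMENSION.**  Certified levels cost `Θ·(u − v) ≤ 8·C·D·g` (A3), killed levels `Θ·u ≤ Θ·g² < 8·D·g` (A4); summing,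
`Θ·(Σ u − Σ v) ≤ 8·(C+1)·D²`. [this file] -/
theorem packing_codim (L Θ D C : ℕ) (g h u v : ℕ → ℕ) (cert : ℕ → Prop) [DecidablePred cert]
    (hD : ∑ t ∈ Finset.range L, g t = D) (hDpos : 0 < D)
    (hcert : ∀ t ∈ Finset.range L, cert t →
      4 * D ≤ Θ * g t ∧ h t = Θ * g t / (4 * D) ∧ h t * (u t - v t) ≤ C * g t ^ 2)
    (hkill : ∀ t ∈ Finset.range L, ¬ cert t → u t ≤ g t ^ 2 ∧ Θ * g t < 8 * D) :
    Θ * (∑ t ∈ Finset.range L, u t - ∑ t ∈ Finset.range L, v t) ≤ 8 * (C + 1) * D ^ 2 := by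
  classical
  -- termwise: Θ·(u t − v t) ≤ 8 (C+1) D · g t
  have hterm : ∀ t ∈ Finset.range L, Θ * (u t - v t) ≤ 8 * (C + 1) * D * g t := by
    intro t ht
    by_cases hc : cert t
    · obtain ⟨h1, h2, h3⟩ := hcert t ht hc
      have hΘt : 1 ≤ Θ * g t / (4 * D) := by
        rw [Nat.le_div_iff_mul_le (by omega), one_mul]; exact h1
      have := certified_cost Θ (g t) D C (u t - v t) hΘt (by rw [← h2]; exact h3)
      calc Θ * (u t - v t) ≤ 8 * C * D * g t := this
        _ ≤ 8 * (C + 1) * D * g t := by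
            apply Nat.mul_le_mul_right; apply Nat.mul_le_mul_right; omega
    · obtain ⟨h1, h2⟩ := hkill t ht hc
      have h3 : Θ * (u t - v t) ≤ Θ * g t ^ 2 := Nat.mul_le_mul_left Θ ((Nat.sub_le _ _).trans h1)
      have h4 : Θ * g t ^ 2 ≤ 8 * D * g t := by
        have : Θ * g t ^ 2 = (Θ * g t) * g t := by ring
        rw [this]; exact Nat.mul_le_mul_right _ h2.le
      calc Θ * (u t - v t) ≤ 8 * D * g t := h3.trans h4
        _ ≤ 8 * (C + 1) * D * g t := by
            apply Nat.mul_le_mul_right; nlinarith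
  -- sum up
  have hsub : ∑ t ∈ Finset.range L, u t - ∑ t ∈ Finset.range L, v t ≤ ∑ t ∈ Finset.range L, (u t - v t) := by
    rw [tsub_le_iff_right, ← Finset.sum_add_distrib]
    exact Finset.sum_le_sum fun t _ => le_tsub_add
  calc Θ * (∑ t ∈ Finset.range L, u t - ∑ t ∈ Finset.range L, v t)
      ≤ Θ * ∑ t ∈ Finset.range L, (u t - v t) := Nat.mul_le_mul_left Θ hsub
    _ = ∑ t ∈ Finset.range L, Θ * (u t - v t) := Finset.mul_sum _ _ _
    _ ≤ ∑ t ∈ Finset.range L, 8 * (C + 1) * D * g t := Finset.sum_le_sum hterm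
    _ = 8 * (C + 1) * D * ∑ t ∈ Finset.range L, g t := (Finset.mul_sum _ _ _).symm
    _ = 8 * (C + 1) * D ^ 2 := by rw [hD]; ring

end Summit.ValiantsHypothesis.ValiantsHypothesis.Theorems.GrenetZeon.HalfSpeed
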